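import Summits.ABC.IUTFork.Repair.RHCreditShellBudget
import HarnessLib

/-!
# R-H ROUND 2 rows 3/4 read LOCALLY — «THE REALISABLE TRIVIAL MASS OF A CELL IS SLOT-LINEAR» (REF-NEGATIVES law N12, «Szpiro in costume»,
# in kernel): `t_j − d⁺_j ≤ j·δ + (j+1)·(R_in − R_out) + (e − 1)` at every label, licensed or not; a LICENSED cell is a local log-Szpiro bound

PROOF-ONLY file (0 definitions, 0 `Prop` facts, no instance, no notation) of the abc-iut cell, rung LADDER-ABC:A2.RESCUE.H, seat
abc-iut-rh2-q2-eq (gen 6; R-H ROUND 2 Q2 rows 3/4/5). It lands, under their own statements, the three theorems of abc-iut-rh3-ref-1's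
staging lemma `N12Lemma.lean` (HOME/abc-iut-rh3-ref-1/, sha16 90e4e466cb8a6d64, «free to land under any typer's name», HOME/STATUS
2026-08-27T03:18:46Z) — the kernel companion of the referee catalogue's law N12 (REF-NEGATIVES-v0.11.md §N12; operational form
REF-N12-TEST.md v1.1, which cites `RH3Ref.N12.trivMass_sub_defplus_le` by staging sha) — and shows that this law and abc-iut-rh2-T-1's
D-0121 R33(4) bookkeeping `RHCreditShellBudget.margin_le_sharp` (p491053) are ONE floor identity (§2), then pools it over the labels of a
place in closed form (§3).

THE INTEGERS (R-W / R-H table columns of ONE packet at ONE place; all of `ℤ`): ramification `e ≥ 1`, local `q`-height `m = m_q` (so the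
`q`-slot has norm `‖ϖ‖^{m}` and the Θ-slot at label `j` has norm `‖ϖ‖^{j²m}`), different exponent `δ`, inner log-shell radius exponent `R_in`,
outer log-shell radius exponent `R_out` ([IUTchIV] Prop. 1.2's radii in `ϖ`-orders; `G := R_in − R_out ≥ 0` is the log-shell span). At label
`j` the sharp-bed exact U2 threshold is `thr_j := e·⌊(j²m − jδ − (j+1)R_in)/e⌋ + (j+1)R_out`, the cell DEFICIT is `d_j := thr_j − m`
(`= −marg` of p491053 with `M := j²m`, `n := j+1`, `D := δ`; abc-iut-rh-typ-4's `cellSlack_diag_orders` p483291 puts `(log p/e)·marg` on the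
REAL cell slack of the diagonal packet), the cell is LICENSED iff `d_j ≤ 0` (rows 3/4 of R-H ROUND 2: abc-iut-rh2-q2-eq's `sigmaNu = licenceCells`,
p470233, read at the integer level by abc-iut-rh2-w-2's `orders_iff_hullCellδ` p484893), and the TRIVIAL MASS of the cell is `t_j := (j² − 1)·m`
(abc-iut-rh2-T-1's `RH.SigmaMass.cellTrivialCost_settingPrVolSharp_eq`, in units of `(log p)/e` per slot).

WHAT IS TYPED (namespace `Summit.ABC.IUTFork.Repair.RH.RealisableMass`).
* §1 THE PER-LABEL LAW (abc-iut-rh3-ref-1's statements VERBATIM): `mul_ediv_ge` (`X − (e−1) ≤ e·⌊X/e⌋`); **`trivMass_sub_defplus_le`**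
  «`t_j − d⁺_j ≤ j·δ + (j+1)·(R_in − R_out) + (e − 1)` for ALL integers, licensed or not» — the REALISABLE part of the trivial mass (what any
  sound cell-level law may keep at this cell: abc-iut-rh2-q2-eq's `keptMass_le_totalTrivialMass_sub_offRemainder_empty`, p487012, is its PN-summed
  setting-level shadow `kept ≤ M − R_∅`) is SLOT-LINEAR in `j`, while `t_j` itself is QUADRATIC; **`trivMass_le_of_licensed`** «`d_j ≤ 0 ⟹
  (j² − 1)·m ≤ j·δ + (j+1)·(R_in − R_out) + (e − 1)`» — A LICENSED CELL IS A LOCAL LOG-SZPIRO BOUND on `m_q` with the chain's own slot-linear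
  right side (rows 3/4 read locally: membership of `(j, w)` in `Σ₄` bounds the local height by different + log-shell data); `sum_trivMass_sub_defplus_le`
  (summed over `j ∈ [1, L]`).
* §2 ONE IDENTITY WITH D-0121: `sub_posPart_neg_le_of_le` (abstract: `marg ≤ −t + B ⟹ t − (−marg)⁺ ≤ B`) and
  **`trivMass_sub_defplus_le_of_margin_le_sharp`** — for `j, δ ∈ ℕ` the per-label law IS p491053's `margin_le_sharp` at `M := j²m`, `n := j+1`,
  `D := δ` followed by that one step (REF-NEGATIVES N12 and R33(4) «the credit is conductor-type» are the same floor bookkeeping, by name).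
* §3 POOLED OVER THE LABELS OF A PLACE, CLOSED FORM (`j = k+1`, `k < L`; `L = l⋇`): `six_mul_sum_range_demand`
  (`6·Σ t_j = (L(L+1)(2L+1) − 6L)·m`), `six_mul_sum_range_budget` (`6·Σ budget_j = 3L(L+1)·δ + 3L(L+3)·(R_in − R_out) + 6L·(e−1)`),
  `sum_range_trivMass_sub_defplus_le`, **`pooled_realisableMass_le`** «`(L(L+1)(2L+1) − 6L)·m − 6·Σ_j d⁺_j ≤ 3L(L+1)·δ + 3L(L+3)·(R_in − R_out) + 6L·(e−1)`»
  and **`pooled_trivMass_le_of_licensed`** (every label `≤ L` licensed ⟹ the same WITHOUT the deficit term: the place's cubic-in-`L` height mass is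
  bounded by its quadratic-in-`L` conductor-type budget — ratio of leading coefficients `(3/2)·(δ + G)/(L·m)`, the referee's `2l·S1/S2' → 6` after the
  print normalisation). READING (REF-NEGATIVES N12, kernel side): summed over places with print's weights, any hypothesis of the shape «total deficit
  `≤ ε`» already contains «`(1 − ε/M)`·height ≤ 6(1+o(1))·(log-diff + log-cond) + O(l)» — the chain's own output shape — WITHOUT [IUTchIII] Cor. 3.12;
  the setting-level sockets of this lineage ([MU-ω-C] of p485439/p488575, [TOL] of p477420) are to be read with this law in hand.
* §4 WORKED ROWS (`decide`, table integers of the HEX `λ₈@l=11` K-line at `p = 7`: `e = 165`, `m = 120`, `δ = 164`, `R_in = 28`, `R_out = −281`):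
  label `j = 5` is UNLICENSED with `d = 174`, realisable mass `2880 − 174 = 2706 ≤ 2838 =` budget; label `j = 4` is LICENSED, `1800 ≤ 2365`; pooled
  over `L = 5`: `6000 − 174 ≤ 9460`.

HONEST FRAMING: pure integer arithmetic of prescribed table columns; which genuine completion carries which `(e, m, δ, R_in, R_out)` is the kit
tables' audit (computed ≠ proved); nothing here decides any cell at genuine data, asserts or denies [IUTchIII] Cor. 3.12, or bears on abc; no
side taken on any author (Mochizuki / Scholze–Stix / Joshi / Dupuy–Hilado); typed ≠ proved for anything not named as a theorem. Referee law
of record: abc-iut-rh3-ref-1 REF-NEGATIVES N12 (statements §1 theirs, credited; proofs re-derived here).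
[cite: Mochizuki2012, IUTchIV Prop. 1.2 (i)(ii) p. 10, Prop. 1.4 (iii) p. 13–14, Thm. 1.10 Step (v) p. 27–28] [cite: DupuyHilado2025, §4.9, §4.12]
[claim: Mochizuki2012, status: disputed] for every quoted construction.
-/

namespace Summit.ABC.IUTFork.Repair.RH.RealisableMass

open Summit.ABC.IUTFork.Repair.RHCreditShellBudget

/-! ## §1. The per-label law (abc-iut-rh3-ref-1's N12 lemma, statements verbatim) -/

/-- Floor lower bound in the form used below: `X − (e − 1) ≤ e·⌊X/e⌋` for `e ≥ 1`. [folklore] -/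
theorem mul_ediv_ge (X e : ℤ) (he : 1 ≤ e) : X - (e - 1) ≤ e * (X / e) := by
  have h1 : e * (X / e) + X % e = X := Int.mul_ediv_add_emod X e
  have h3 : X % e < e := Int.emod_lt_of_pos X (by omega)
  linarith

/-- **N12 per-label law (abc-iut-rh3-ref-1).** The realisable trivial mass `t_j − d⁺_j` at the sharp bed is slot-linear:
`(j² − 1)·m − max 0 (e·⌊(j²m − jδ − (j+1)R_in)/e⌋ + (j+1)R_out − m) ≤ j·δ + (j+1)·(R_in − R_out) + (e − 1)`, for ALL integers
(`e ≥ 1`), licensed or not. [cite: DupuyHilado2025, §4.12] [claim: Mochizuki2012, status: disputed] -/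
theorem trivMass_sub_defplus_le (m e δ Rin Rout j : ℤ) (he : 1 ≤ e) :
    (j ^ 2 - 1) * m - max 0 (e * ((j ^ 2 * m - j * δ - (j + 1) * Rin) / e) + (j + 1) * Rout - m)
      ≤ j * δ + (j + 1) * (Rin - Rout) + (e - 1) := by
  have hfl := mul_ediv_ge (j ^ 2 * m - j * δ - (j + 1) * Rin) e he
  rcases le_total 0 (e * ((j ^ 2 * m - j * δ - (j + 1) * Rin) / e) + (j + 1) * Rout - m) with h | h
  · rw [max_eq_right h]; linarith
  · rw [max_eq_left h]; linarith

/-- **A LICENSED CELL IS A LOCAL LOG-SZPIRO BOUND** (the licensed case of the law, read on its own): if the cell at label `j` is licensed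
(`d_j ≤ 0`: the exact U2 threshold does not exceed the `q`-height) then the trivial mass itself is slot-linear,
`(j² − 1)·m ≤ j·δ + (j+1)·(R_in − R_out) + (e − 1)` — rows 3/4 of R-H ROUND 2 read locally (row 3 / transfer-1 (ii) in the referee's words).
[cite: DupuyHilado2025, §4.12] [claim: Mochizuki2012, status: disputed] -/
theorem trivMass_le_of_licensed (m e δ Rin Rout j : ℤ) (he : 1 ≤ e)
    (hlic : e * ((j ^ 2 * m - j * δ - (j + 1) * Rin) / e) + (j + 1) * Rout - m ≤ 0) :
    (j ^ 2 - 1) * m ≤ j * δ + (j + 1) * (Rin - Rout) + (e - 1) := by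
  have h := trivMass_sub_defplus_le m e δ Rin Rout j he
  rw [max_eq_left hlic] at h
  linarith

/-- Summed form over the labels `1 … L` (as a `Finset.sum` over `Finset.Icc 1 L` in `ℤ`): the realisable mass of a place is bounded by the
slot-linear total. [cite: DupuyHilado2025, §4.12] [claim: Mochizuki2012, status: disputed] -/
theorem sum_trivMass_sub_defplus_le (m e δ Rin Rout : ℤ) (he : 1 ≤ e) (L : ℕ) :
    (∑ j ∈ Finset.Icc (1 : ℤ) L, ((j ^ 2 - 1) * m -
        max 0 (e * ((j ^ 2 * m - j * δ - (j + 1) * Rin) / e) + (j + 1) * Rout - m)))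
      ≤ ∑ j ∈ Finset.Icc (1 : ℤ) L, (j * δ + (j + 1) * (Rin - Rout) + (e - 1)) := by
  apply Finset.sum_le_sum
  intro j _
  exact trivMass_sub_defplus_le m e δ Rin Rout j he

/-! ## §2. One identity with D-0121 R33(4): the law from `RHCreditShellBudget.margin_le_sharp` -/

/-- Abstract step: if a margin satisfies `marg ≤ −t + B` then `t − (−marg)⁺ ≤ B` (for `marg ≤ 0` this is `t + marg ≤ B`; for `marg ≥ 0`
it is `t ≤ B − marg ≤ B`). [folklore] -/
theorem sub_posPart_neg_le_of_le {t marg B : ℤ} (h : marg ≤ -t + B) : t - max 0 (-marg) ≤ B := by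
  rcases le_total 0 (-marg) with hm | hm
  · rw [max_eq_right hm]; linarith
  · rw [max_eq_left hm]; linarith

/-- **THE N12 LAW IS p491053's FLOOR BOOKKEEPING.** For natural `j, δ` the per-label law follows in one step from abc-iut-rh2-T-1's
`RHCreditShellBudget.margin_le_sharp` at `M := j²m`, `n := j+1`, `D := δ` (whose margin is `−d_j`): REF-NEGATIVES N12 and D-0121 R33(4)
«the credit is conductor-type» are the same identity `e·⌊X/e⌋ ≥ X − (e−1)`, read once for the realisable mass and once for the credit.
[cite: DupuyHilado2025, §4.12] [claim: Mochizuki2012, status: disputed] -/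
theorem trivMass_sub_defplus_le_of_margin_le_sharp (m e Rin Rout : ℤ) (he : 0 < e) (j δ : ℕ) :
    ((j : ℤ) ^ 2 - 1) * m - max 0 (e * (((j : ℤ) ^ 2 * m - (j : ℤ) * (δ : ℤ) - ((j : ℤ) + 1) * Rin) / e) + ((j : ℤ) + 1) * Rout - m)
      ≤ (j : ℤ) * (δ : ℤ) + ((j : ℤ) + 1) * (Rin - Rout) + (e - 1) := by
  have h := margin_le_sharp he (j + 1) δ Rin Rout ((j : ℤ) ^ 2 * m) m
  simp only [Nat.add_sub_cancel] at h
  push_cast at h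
  have h' : m - e * (((j : ℤ) ^ 2 * m - (j : ℤ) * (δ : ℤ) - ((j : ℤ) + 1) * Rin) / e) - ((j : ℤ) + 1) * Rout ≤
      -(((j : ℤ) ^ 2 - 1) * m) + ((j : ℤ) * (δ : ℤ) + ((j : ℤ) + 1) * (Rin - Rout) + (e - 1)) := by
    linarith
  have := sub_posPart_neg_le_of_le h'
  -- `-(marg) = d_j`
  have hneg : -(m - e * (((j : ℤ) ^ 2 * m - (j : ℤ) * (δ : ℤ) - ((j : ℤ) + 1) * Rin) / e) - ((j : ℤ) + 1) * Rout) =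
      e * (((j : ℤ) ^ 2 * m - (j : ℤ) * (δ : ℤ) - ((j : ℤ) + 1) * Rin) / e) + ((j : ℤ) + 1) * Rout - m := by ring
  rw [hneg] at this
  exact this

/-! ## §3. Pooled over the labels of a place, in closed form -/

/-- `6·Σ_{k<L} ((k+1)² − 1)·m = (L(L+1)(2L+1) − 6L)·m` (`Σ j² = L(L+1)(2L+1)/6`, `Σ 1 = L`). [folklore] -/
theorem six_mul_sum_range_demand (m : ℤ) (L : ℕ) :
    6 * ∑ k ∈ Finset.range L, ((((k : ℤ) + 1) ^ 2 - 1) * m) = ((L : ℤ) * (L + 1) * (2 * L + 1) - 6 * L) * m := by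
  induction L with
  | zero => simp
  | succ n ih =>
    rw [Finset.sum_range_succ, mul_add, ih]
    push_cast
    ring

/-- `6·Σ_{k<L} ((k+1)·δ + (k+2)·(R_in − R_out) + (e−1)) = 3L(L+1)·δ + 3L(L+3)·(R_in − R_out) + 6L·(e−1)`. [folklore] -/
theorem six_mul_sum_range_budget (e δ Rin Rout : ℤ) (L : ℕ) :
    6 * ∑ k ∈ Finset.range L, (((k : ℤ) + 1) * δ + ((k : ℤ) + 1 + 1) * (Rin - Rout) + (e - 1)) =
      3 * (L : ℤ) * (L + 1) * δ + 3 * (L : ℤ) * (L + 3) * (Rin - Rout) + 6 * (L : ℤ) * (e - 1) := by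
  induction L with
  | zero => simp
  | succ n ih =>
    rw [Finset.sum_range_succ, mul_add, ih]
    push_cast
    ring

/-- The per-label law summed over `j = k+1`, `k < L`. [cite: DupuyHilado2025, §4.12] [claim: Mochizuki2012, status: disputed] -/
theorem sum_range_trivMass_sub_defplus_le (m e δ Rin Rout : ℤ) (he : 1 ≤ e) (L : ℕ) :
    ∑ k ∈ Finset.range L, (((((k : ℤ) + 1) ^ 2 - 1) * m) -
        max 0 (e * ((((k : ℤ) + 1) ^ 2 * m - ((k : ℤ) + 1) * δ - ((k : ℤ) + 1 + 1) * Rin) / e) + ((k : ℤ) + 1 + 1) * Rout - m))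
      ≤ ∑ k ∈ Finset.range L, (((k : ℤ) + 1) * δ + ((k : ℤ) + 1 + 1) * (Rin - Rout) + (e - 1)) :=
  Finset.sum_le_sum fun k _ => trivMass_sub_defplus_le m e δ Rin Rout ((k : ℤ) + 1) he

/-- **POOLED LAW, CLOSED FORM**: over the labels `1 … L` of a place,
`(L(L+1)(2L+1) − 6L)·m − 6·Σ_j d⁺_j ≤ 3L(L+1)·δ + 3L(L+3)·(R_in − R_out) + 6L·(e − 1)` — cubic-in-`L` height mass minus the total positive
deficit is at most the quadratic-in-`L` conductor-type budget. [cite: DupuyHilado2025, §4.12] [claim: Mochizuki2012, status: disputed] -/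
theorem pooled_realisableMass_le (m e δ Rin Rout : ℤ) (he : 1 ≤ e) (L : ℕ) :
    ((L : ℤ) * (L + 1) * (2 * L + 1) - 6 * L) * m -
        6 * ∑ k ∈ Finset.range L,
          max 0 (e * ((((k : ℤ) + 1) ^ 2 * m - ((k : ℤ) + 1) * δ - ((k : ℤ) + 1 + 1) * Rin) / e) + ((k : ℤ) + 1 + 1) * Rout - m)
      ≤ 3 * (L : ℤ) * (L + 1) * δ + 3 * (L : ℤ) * (L + 3) * (Rin - Rout) + 6 * (L : ℤ) * (e - 1) := by
  have h := sum_range_trivMass_sub_defplus_le m e δ Rin Rout he L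
  rw [Finset.sum_sub_distrib] at h
  have h1 := six_mul_sum_range_demand m L
  have h2 := six_mul_sum_range_budget e δ Rin Rout L
  linarith

/-- **A FULLY LICENSED PLACE IS A LOCAL SZPIRO BOUND**: if every label `j ≤ L` of the place is licensed (`d_j ≤ 0`), then
`(L(L+1)(2L+1) − 6L)·m ≤ 3L(L+1)·δ + 3L(L+3)·(R_in − R_out) + 6L·(e − 1)`: to leading order in `L` the local `q`-height obeys
`m ≲ (3/(2L))·(δ + G)`, `G = R_in − R_out` — different + log-shell span, slot-linear data; cubic-vs-quadratic in `L`. [cite: DupuyHilado2025, §4.12] [claim: Mochizuki2012, status: disputed] -/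
theorem pooled_trivMass_le_of_licensed (m e δ Rin Rout : ℤ) (he : 1 ≤ e) (L : ℕ)
    (hlic : ∀ k < L,
      e * ((((k : ℤ) + 1) ^ 2 * m - ((k : ℤ) + 1) * δ - ((k : ℤ) + 1 + 1) * Rin) / e) + ((k : ℤ) + 1 + 1) * Rout - m ≤ 0) :
    ((L : ℤ) * (L + 1) * (2 * L + 1) - 6 * L) * m
      ≤ 3 * (L : ℤ) * (L + 1) * δ + 3 * (L : ℤ) * (L + 3) * (Rin - Rout) + 6 * (L : ℤ) * (e - 1) := by
  have h := pooled_realisableMass_le m e δ Rin Rout he L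
  have h0 : ∑ k ∈ Finset.range L,
      max 0 (e * ((((k : ℤ) + 1) ^ 2 * m - ((k : ℤ) + 1) * δ - ((k : ℤ) + 1 + 1) * Rin) / e) + ((k : ℤ) + 1 + 1) * Rout - m) = 0 :=
    Finset.sum_eq_zero fun k hk => max_eq_left (hlic k (Finset.mem_range.mp hk))
  rw [h0, mul_zero, sub_zero] at h
  exact h

/-! ## §4. Worked rows of the HEX `λ₈@l=11` K-line at `p = 7` (`e = 165`, `m = 120`, `δ = 164`, `R_in = 28`, `R_out = −281`) -/

/-- Label `j = 5` (UNLICENSED): deficit `d = 174 > 0`, realisable mass `24·120 − 174 = 2706`, budget `5·164 + 6·309 + 164 = 2838`. [folklore] -/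
example :
    (165 : ℤ) * (((5 : ℤ) ^ 2 * 120 - 5 * 164 - (5 + 1) * 28) / 165) + (5 + 1) * (-281) - 120 = 174 ∧
    ((5 : ℤ) ^ 2 - 1) * 120 - max 0 ((165 : ℤ) * (((5 : ℤ) ^ 2 * 120 - 5 * 164 - (5 + 1) * 28) / 165) + (5 + 1) * (-281) - 120)
        = 2706 ∧
    (5 : ℤ) * 164 + (5 + 1) * (28 - (-281)) + (165 - 1) = 2838 := by
  decide

/-- Label `j = 4` (LICENSED): deficit `d = −535 ≤ 0`, so the trivial mass itself obeys the law: `15·120 = 1800 ≤ 4·164 + 5·309 + 164 = 2365`. [folklore] -/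
example :
    (165 : ℤ) * (((4 : ℤ) ^ 2 * 120 - 4 * 164 - (4 + 1) * 28) / 165) + (4 + 1) * (-281) - 120 = -535 ∧
    ((4 : ℤ) ^ 2 - 1) * 120 = 1800 ∧ (4 : ℤ) * 164 + (4 + 1) * (28 - (-281)) + (165 - 1) = 2365 := by
  decide

/-- The licensed row `j = 4` as an instance of `trivMass_le_of_licensed`. [folklore] -/
example : ((4 : ℤ) ^ 2 - 1) * 120 ≤ 4 * 164 + (4 + 1) * (28 - (-281)) + (165 - 1) :=
  trivMass_le_of_licensed 120 165 164 28 (-281) 4 (by norm_num) (by decide)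

/-- Pooled over `L = 5` (`l⋇ = 5` at `l = 11`): `6·Σ t_j = (5·6·11 − 30)·120 = 36000` (`Σ t_j = 6000`), `6·Σ budget_j = 56760` (`Σ = 9460`),
`Σ d⁺_j = 174` (only `j = 5` is unlicensed): `36000 − 6·174 = 34956 ≤ 56760`. [folklore] -/
example : ((5 : ℤ) * (5 + 1) * (2 * 5 + 1) - 6 * 5) * 120 = 36000 ∧
    3 * (5 : ℤ) * (5 + 1) * 164 + 3 * 5 * (5 + 3) * (28 - (-281)) + 6 * 5 * (165 - 1) = 56760 ∧
    (36000 : ℤ) - 6 * 174 ≤ 56760 := by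
  decide

end Summit.ABC.IUTFork.Repair.RH.RealisableMass
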